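import Summits.BirchSwinnertonDyer.BirchSwinnertonDyer.Theses.RamifiedHeegnerPair
import Literature.NumberTheory.DiophantineGeometry.TateAlgorithm
import Literature.NumberTheory.EllipticCurves.RootNumber

/-!
# Sketch — psjointram First lemma (pen pss3 g25; NOT a tree file, NOT registered, nothing proved)

Crux: `Summit.BirchSwinnertonDyer.BirchSwinnertonDyer.Theses.RamifiedHeegnerPair.LeafRankOneUpperAtThree`
(stmt-BirchSwinnertonDyer-26022). Idea `psjointram` (LEAD-G21-DATUM §§2–6): on a PS row (additive carrier
`q ≡ 1 (mod 3)`, Kodaira IV/IV*, `c_q = 3`) take `K` imaginary quadratic RAMIFIED at `q` with every other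
bad prime split. First checkable statement = the sign / type bookkeeping below; the research content of
the line starts one step later, at `(Man_U, 3)`.
-/

namespace Summit.BirchSwinnertonDyer.BirchSwinnertonDyer.Cruxes.LeafRankOneUpperAtThree.Psjointram

open WeierstrassCurve IsDedekindDomain NumberField
open Literature.NumberTheory.DiophantineGeometry

/-- **psjointram — First lemma (sign and local types under joint ramification).**
`W/ℚ` globally minimal elliptic of conductor `N`, `q ∣ N` a prime with `q ≡ 1 (mod 3)` at which `W` has
Kodaira type `IV` or `IV*` and Tamagawa number `3` (principal-series carrier); `K` imaginary quadratic with
`q` ramified and every other prime of `N` split; `Wd` a globally minimal model of the twist `W ⊗ χ_K`. Then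
(1) the pair has global sign `−1`: `w(W)·w(Wd) = −1` (Kohen–Pacetti arXiv:1505.08059 §2; local computation
`w_q(W) w_q(W ⊗ χ_q) = χ_q(−1)` for a PS type); (2) the partner LOSES the carrier: `Wd` has Tamagawa number
`1` at `q` (type `II`/`II*`, `v_q(Δ) ↦ v_q(Δ) + 6 (mod 12)`); (3) over the ramified completion `K_𝔮 ⊋ ℚ_q`
the carrier still pays exactly one `3`: `c_𝔮(W/K) = 3` (`W(ℚ_q)[3] ≠ 0` maps onto `Φ_𝔮`, `#Φ_𝔮 ∣ 3`).
Sources: KP 1505.08059 §2; Silverman ATAEC IV.9.4 (Tate), Table 4.1; CST arXiv:1408.1733 Def 1.3/1.4.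
Bookkeeping only — provable from Tate's algorithm + the local root number table; `sorry` here on purpose. -/
theorem psJointRam_sign_and_types
    (W : WeierstrassCurve ℚ) [W.IsElliptic] [W.IsGloballyMinimal] (N : ℕ) [NeZero N]
    (hN : W.conductorNorm ℤ = N) (q : ℕ) [hq : Fact q.Prime] (hq3 : q % 3 = 1) (hqN : q ∣ N)
    (hIV : W.kodairaSymbolAt ((Rat.HeightOneSpectrum.primesEquiv (R := ℤ)).symm ⟨q, hq.out⟩) = .IV ∨
      W.kodairaSymbolAt ((Rat.HeightOneSpectrum.primesEquiv (R := ℤ)).symm ⟨q, hq.out⟩) = .IVstar)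
    (hc : (W.baseChange ℚ_[q]).localTamagawaNumber ℤ_[q] = 3)
    (K : Type) [Field K] [NumberField K]
    (hK : Literature.NumberTheory.EllipticCurves.IsImaginaryQuadratic K)
    (hram : (q : ℤ) ∣ NumberField.discr K)
    (hsplit : ∀ p : ℕ, p.Prime → p ∣ N → p ≠ q → ((Ideal.span {(p : ℤ)}).primesOver (𝓞 K)).ncard = 2)
    (Wd : WeierstrassCurve ℚ) [Wd.IsElliptic] [Wd.IsGloballyMinimal] (Cd : VariableChange ℚ)
    (hWd : Cd • W.quadraticTwist (NumberField.discr K : ℚ) = Wd) :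
    W.rootNumber * Wd.rootNumber = -1 ∧
      (Wd.baseChange ℚ_[q]).localTamagawaNumber ℤ_[q] = 1 ∧
      (∀ v : HeightOneSpectrum (𝓞 K), (q : 𝓞 K) ∈ v.asIdeal →
        ((W.baseChange K).baseChange (v.adicCompletion K)).localTamagawaNumber
          (v.adicCompletionIntegers K) = 3) := by
  sorry

end Summit.BirchSwinnertonDyer.BirchSwinnertonDyer.Cruxes.LeafRankOneUpperAtThree.Psjointram
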